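import Mathlib
import HarnessLib
import Literature.Computability.AlgebraicComplexity.PatternExpressions
import Literature.Combinatorics.SimpleGraph.TreeDecomposition
import Summits.ValiantsHypothesis.ValiantsHypothesis.Theorems.MonotoneRestorationMonotoneRestorationQPLinearWidthOrbitSeparation

/-!
# Route MonotoneRestoration, crux `MonotoneRestorationQP` (stmt-15886), line `linear-width` —
# DETERMINED POLYNOMIALS ARE MATRIX-SYMMETRIC: in `WidthRung d`, `WidthRestorationQP` and
# `HomDeterminedVP` the hypothesis `IsMatrixSymmetric` is implied by the width hypothesis

Helper file (`--supports stmt-ValiantsHypothesis-15886`), def-free.  The nodes of line `linear-width`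
read `IsMatrixSymmetric f → IsVPFamily f → PolylogHomDetermined f → QPOrbitSymm f` (`WidthRung d`,
`WidthRestorationQP`) and `IsMatrixSymmetric f → IsVPFamily f → PolylogHomDetermined f`
(`HomDeterminedVP`).  This file certifies that the FIRST hypothesis is REDUNDANT in the former: a
polynomial determined by `HomIndist n k` — for ANY `k` — is invariant under independent row and column
permutations, because homomorphism polynomials are (`OrbitSeparation.eval_homPoly_perm`), so every point
is hom-indistinguishable from each of its row/column permutations, and a polynomial over `ℂ` is its
function (`MvPolynomial.funext`):

* `homIndist_perm` — `HomIndist n k A (A ∘ (σ × τ))` for all `k, σ, τ` (unfolded verbatim);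
* `rename_eq_of_determined` — determined by `HomIndist n k` ⇒ matrix-symmetric;
* `matrixSymmetric_of_polylogHomDetermined` — `PolylogHomDetermined f` (unfolded verbatim) ⇒
  `∀ n σ τ, rename (σ × τ) (f n) = f n` (= `IsMatrixSymmetric f` of the line, unfolded);
* `determined_iff_top` — with `OrbitSeparation.eval_eq_of_homIndist_of_matrixSymmetric`: for
  `N ≥ 4·(n!)²`, "determined by `HomIndist n N`" is EQUIVALENT to matrix symmetry — the set `D_N(n)` of
  determined polynomials is exactly the invariant ring at the top of the scale, and `D_k(n)` increases
  from the constants (`k = 1`, `DeterminedVsNarrow`) to the invariants inside it.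

Honest label: bookkeeping on the line's hypotheses; no stub closed; VP ≠ VNP not moved.
[cite: DwivediPagoSeppelt2026, Def. 3.2]
-/

-- `Summit.ValiantsHypothesis.ValiantsHypothesis.…` is the tree's mandated namespace (Sub = Summit).
set_option linter.dupNamespace false

noncomputable section

namespace Summit.ValiantsHypothesis.ValiantsHypothesis.Theorems

namespace DeterminedSymmetric

open Literature.Computability.AlgebraicComplexity MvPolynomial

variable {n : ℕ}

/-- **Every point is hom-indistinguishable (below any treewidth) from its row/column permutations.**
[folklore] -/
theorem homIndist_perm {k : ℕ} (A : Fin n × Fin n → ℂ) (σ τ : Equiv.Perm (Fin n)) :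
    ∀ (a b : ℕ) (E : Multiset (Fin a × Fin b)),
      Literature.Combinatorics.SimpleGraph.treewidth
        (SimpleGraph.fromRel fun u v : Fin a ⊕ Fin b => ∃ p ∈ E, u = Sum.inl p.1 ∧ v = Sum.inr p.2) < k →
      eval A (homPoly E n ℂ) = eval (fun ij : Fin n × Fin n => A (σ ij.1, τ ij.2)) (homPoly E n ℂ) :=
  fun _ _ E _ => (OrbitSeparation.eval_homPoly_perm A σ τ E).symm

/-- **Determined polynomials are matrix-symmetric.**  A polynomial taking equal values at any two points
hom-indistinguishable below treewidth `k` (`HomIndist n k`, unfolded verbatim; `k` arbitrary) is invariant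
under independent row and column permutations. [folklore] -/
theorem rename_eq_of_determined {k : ℕ} (p : MvPolynomial (Fin n × Fin n) ℂ)
    (hp : ∀ A B : Fin n × Fin n → ℂ,
      (∀ (a b : ℕ) (E : Multiset (Fin a × Fin b)),
        Literature.Combinatorics.SimpleGraph.treewidth
          (SimpleGraph.fromRel fun u v : Fin a ⊕ Fin b => ∃ p ∈ E, u = Sum.inl p.1 ∧ v = Sum.inr p.2) < k →
        eval A (homPoly E n ℂ) = eval B (homPoly E n ℂ)) →
      eval A p = eval B p)
    (σ τ : Equiv.Perm (Fin n)) :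
    rename (fun ij : Fin n × Fin n => (σ ij.1, τ ij.2)) p = p := by
  refine MvPolynomial.funext fun A => ?_
  rw [eval_rename]
  exact (hp A _ (homIndist_perm A σ τ)).symm

/-- **`PolylogHomDetermined f` implies matrix symmetry of `f`** (both unfolded verbatim from line
`linear-width`): the hypothesis `IsMatrixSymmetric f` of `WidthRung d` / `WidthRestorationQP` is implied by
the width hypothesis. [folklore] -/
theorem matrixSymmetric_of_polylogHomDetermined (f : (n : ℕ) → MvPolynomial (Fin n × Fin n) ℂ)
    (hdet : ∃ c : ℕ, ∀ (n : ℕ) (A B : Fin n × Fin n → ℂ),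
      (∀ (a b : ℕ) (E : Multiset (Fin a × Fin b)),
        Literature.Combinatorics.SimpleGraph.treewidth
          (SimpleGraph.fromRel fun u v : Fin a ⊕ Fin b => ∃ p ∈ E, u = Sum.inl p.1 ∧ v = Sum.inr p.2) <
          (Nat.log 2 n + c) ^ c →
        MvPolynomial.eval A (homPoly E n ℂ) = MvPolynomial.eval B (homPoly E n ℂ)) →
      MvPolynomial.eval A (f n) = MvPolynomial.eval B (f n)) :
    ∀ (n : ℕ) (σ τ : Equiv.Perm (Fin n)),
      MvPolynomial.rename (fun p : Fin n × Fin n => (σ p.1, τ p.2)) (f n) = f n := by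
  obtain ⟨c, hc⟩ := hdet
  exact fun n σ τ => rename_eq_of_determined (f n) (hc n) σ τ

/-- **At the top of the scale DETERMINED = MATRIX-SYMMETRIC.**  For `N ≥ 4·(n!)²`, a polynomial is
determined by `HomIndist n N` iff it is invariant under independent row and column permutations.
[folklore] -/
theorem determined_iff_matrixSymmetric {N : ℕ} (hN : 4 * (Nat.factorial n) ^ 2 ≤ N)
    (p : MvPolynomial (Fin n × Fin n) ℂ) :
    (∀ A B : Fin n × Fin n → ℂ,
      (∀ (a b : ℕ) (E : Multiset (Fin a × Fin b)),
        Literature.Combinatorics.SimpleGraph.treewidth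
          (SimpleGraph.fromRel fun u v : Fin a ⊕ Fin b => ∃ p ∈ E, u = Sum.inl p.1 ∧ v = Sum.inr p.2) < N →
        eval A (homPoly E n ℂ) = eval B (homPoly E n ℂ)) →
      eval A p = eval B p) ↔
    ∀ σ τ : Equiv.Perm (Fin n), rename (fun ij : Fin n × Fin n => (σ ij.1, τ ij.2)) p = p :=
  ⟨fun hp => rename_eq_of_determined p hp, fun hp A B hind =>
    OrbitSeparation.eval_eq_of_homIndist_of_matrixSymmetric p hp hN A B hind⟩

/-- **Monotonicity of the scale**: determined below treewidth `k` implies determined below every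
`k' ≥ k`. [folklore] -/
theorem determined_mono {k k' : ℕ} (hkk' : k ≤ k') (p : MvPolynomial (Fin n × Fin n) ℂ)
    (hp : ∀ A B : Fin n × Fin n → ℂ,
      (∀ (a b : ℕ) (E : Multiset (Fin a × Fin b)),
        Literature.Combinatorics.SimpleGraph.treewidth
          (SimpleGraph.fromRel fun u v : Fin a ⊕ Fin b => ∃ p ∈ E, u = Sum.inl p.1 ∧ v = Sum.inr p.2) < k →
        eval A (homPoly E n ℂ) = eval B (homPoly E n ℂ)) →
      eval A p = eval B p) :
    ∀ A B : Fin n × Fin n → ℂ,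
      (∀ (a b : ℕ) (E : Multiset (Fin a × Fin b)),
        Literature.Combinatorics.SimpleGraph.treewidth
          (SimpleGraph.fromRel fun u v : Fin a ⊕ Fin b => ∃ p ∈ E, u = Sum.inl p.1 ∧ v = Sum.inr p.2) < k' →
        eval A (homPoly E n ℂ) = eval B (homPoly E n ℂ)) →
      eval A p = eval B p :=
  fun A B hind => hp A B fun a b E hE => hind a b E (hE.trans_le hkk')

end DeterminedSymmetric

end Summit.ValiantsHypothesis.ValiantsHypothesis.Theorems

end
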